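import Literature.NumberTheory.Automorphic.AutomorphicRepsGLCuspidalL2Step1Bump
import Literature.NumberTheory.Automorphic.TestFunctionGLLeftInvariance
import Literature.NumberTheory.Automorphic.LocalComponentGeneric
import HarnessLib

/-!
# A non-zero test-function smoothing in every cuspidal representation, with a level

Topic `NumberTheory/Automorphic`; namespace `Literature.NumberTheory.Automorphic`. Proof file
(theorems only: no definition, no named fact). The real-point Rankin–Selberg programme behind
Jacquet–Shalika (1981), Lemma (5.2) / Thm. (5.3) (`RankinSelbergTorusIntegral`,
`RankinSelbergSiegelFiniteness`, `GLnCuspidalSiegelDecay`, `RankinSelbergTorusPositivity`) works with a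
vector `φ = S_η f` of the cuspidal representation `Π` smoothed by a weight `η` which must be, at the
same time: a **test function** (`IsTestFunctionGL`: smooth at infinity and of finite level, so that
`S_η f` is rapidly decreasing, `isRapidlyDecreasingGL_invQuot_smoothedForm`), **left invariant under
a principal congruence subgroup `K(𝔫₀)`** (so that `S_η f` is spherical and Hecke at the places
`v ∤ 𝔫₀`, `exists_isTorusUnramifiedAt_whittakerCoeff_smoothedForm`), and such that **`S_η f ≠ 0`**
(genericity then gives `W_φ ≢ 0`). This file records that such data exist in every cuspidal `Π`
(Getz–Hahn (2024), proof of Lemma 9.8.2, printed p. 192: "every vector `φ ∈ V_fin` is fixed by a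
compact open subgroup `K' ≤ K`, so `π(𝟙_{K'}) φ = φ`" — here in the soft form: a bump `η ≥ 0` of
positive mass supported where `Re ⟪f, R(g) f⟫ > ‖f‖²/2` has `R(η) f ≠ 0`):

* `exists_isTestFunctionGL_smoothedForm_ne_zero` — for a closed invariant `W ≤ L²` and
  `0 ≠ f ∈ W` there is a test function `η ≥ 0` with `S_η f ≠ 0` and an ideal `𝔫₀ ≠ 0` with
  `η (k g) = η g` for all `k ∈ K(𝔫₀)` (the bump of
  `AutomorphicRepsGL.exists_adInvariant_symmetric_testWeight_holds`, the non-vanishing of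
  `smoothedVector_ne_zero_of_support_subset`, `smoothedForm_ne_zero_of_smoothedVector_ne_zero`, and
  the automatic left level of a test function `IsTestFunctionGL.exists_forall_mul_left_eq`);
* `CuspidalAutomorphicRepGL.exists_isTestFunctionGL_smoothedForm_ne_zero` — the same for a cuspidal
  automorphic representation `Π` (irreducible, hence non-zero), with `f ∈ Π`.

Everything is proved; folklore.

## References

* J. R. Getz, H. Hahn, *An Introduction to Automorphic Representations*, GTM 300 (2024), proof of
  Lemma 9.8.2 (printed p. 192) [GetzHahn2024].
* H. Jacquet, J. A. Shalika, Amer. J. Math. 103 (1981), §5, (5.1) (the choice of `φ` and `S`)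
  [JacquetShalikaAJM1981].
-/

noncomputable section

open MeasureTheory Measure NumberField IsDedekindDomain Set Filter
open scoped MatrixGroups ENNReal NNReal Topology

namespace Literature.NumberTheory.Automorphic

section TestVector

variable {n : ℕ} {K : Type} [Field K] [NumberField K]
  {μ : Measure (AdelicGroupData.gl n K).automorphicQuotient}
  [(AdelicGroupData.gl n K).IsAutomorphicMeasure μ]

attribute [local instance] adelicBorel borelSpace_adelic locallyCompactSpace_adelic
  secondCountableTopology_gl_adelic

/-- **A non-zero test-function smoothing with a level.** For a closed invariant subspace `W ≤ L²`
of the automorphic quotient of `GL_n` and `0 ≠ f ∈ W` there are a test function `η ≥ 0`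
(`IsTestFunctionGL`) with `S_η f ≠ 0` and an ideal `𝔫₀ ≠ 0` such that `η` is left invariant under the
principal congruence subgroup `K(𝔫₀)`. [folklore] -/
theorem exists_isTestFunctionGL_smoothedForm_ne_zero
    (W : ContRepresentation.ClosedSubrep ((AdelicGroupData.gl n K).rightRegular μ))
    {f : W.toSubmodule} (hf0 : f ≠ 0) :
    ∃ η : (AdelicGroupData.gl n K).Adelic → ℝ, IsTestFunctionGL n K η ∧ 0 ≤ η ∧
      smoothedForm η ((f : W.toSubmodule) : (AdelicGroupData.gl n K).L2 μ) ≠ 0 ∧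
      ∃ 𝔫₀ : Ideal (𝓞 K), 𝔫₀ ≠ 0 ∧
        ∀ k : (AdelicGroupData.gl n K).Adelic, k ∈ principalCongruenceLevel n K 𝔫₀ →
          ∀ g : (AdelicGroupData.gl n K).Adelic, η (k * g) = η g := by
  set F := ((f : W.toSubmodule) : (AdelicGroupData.gl n K).L2 μ) with hF
  -- the open neighbourhood of `1` where `Re ⟪F, R(g) F⟫ > ‖F‖²/2`
  set V : Set (AdelicGroupData.gl n K).Adelic :=
    {g | ‖F‖ ^ 2 / 2 < RCLike.re (inner ℂ F ((AdelicGroupData.gl n K).rightRegular μ g F))} with hV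
  have hcont : Continuous fun g =>
      RCLike.re (inner ℂ F ((AdelicGroupData.gl n K).rightRegular μ g F)) :=
    RCLike.continuous_re.comp (continuous_const.inner
      ((AdelicGroupData.isStronglyContinuous_rightRegular_holds (AdelicGroupData.gl n K) μ) F))
  have hVo : IsOpen V := isOpen_lt continuous_const hcont
  have hF0 : F ≠ 0 := fun h => hf0 (Subtype.ext h)
  have h1V : (1 : (AdelicGroupData.gl n K).Adelic) ∈ V := by
    change ‖F‖ ^ 2 / 2 < RCLike.re (inner ℂ F ((AdelicGroupData.gl n K).rightRegular μ 1 F))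
    rw [map_one]
    change ‖F‖ ^ 2 / 2 < RCLike.re (inner ℂ F F)
    rw [inner_self_eq_norm_sq_to_K]
    norm_cast
    have : 0 < ‖F‖ ^ 2 := by positivity
    linarith
  -- the bump weight of positive mass supported in `V`
  obtain ⟨U, -, η, hη, hη0, -, -, -, hmass, hsupp⟩ :=
    AutomorphicRepsGL.exists_adInvariant_symmetric_testWeight_holds n K
      (isCompact_glFiniteIntegralLevel_holds n K) V (hVo.mem_nhds h1V)
  have hηc : Continuous η := hη.continuous
  have hηs : HasCompactSupport η := hη.hasCompactSupport
  have hne : smoothedVector W η f ≠ 0 :=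
    smoothedVector_ne_zero_of_support_subset W hηc hηs hη0 hmass hf0 hsupp
  have hFne : smoothedForm η F ≠ 0 := smoothedForm_ne_zero_of_smoothedVector_ne_zero hηc hηs hne
  -- the automatic left level of a test function
  obtain ⟨𝔫₀, h𝔫₀, hηK⟩ := hη.exists_forall_mul_left_eq
  exact ⟨η, hη, hη0, hFne, 𝔫₀, h𝔫₀, fun k hk g => hηK k hk g⟩

/-- **In every cuspidal automorphic representation of `GL_n(𝔸_K)` there is a non-zero test-function
smoothing with a level**: for `Π` cuspidal (an irreducible closed invariant subspace of `L²_cusp`)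
there are `f ∈ Π`, a test function `η ≥ 0` with `S_η f ≠ 0`, and `𝔫₀ ≠ 0` with `η` left
`K(𝔫₀)`-invariant — the data `(f, η, 𝔫₀)` of `exists_isTorusUnramifiedAt_whittakerCoeff_smoothedForm` /
`exists_prod_schurSelfSum_le_of_cuspidal` (`RankinSelbergTorusIntegral`) with, in addition, the
smoothness needed for rapid decay (`isRapidlyDecreasingGL_invQuot_smoothedForm`) and `S_η f ≠ 0`.
[folklore] -/
theorem CuspidalAutomorphicRepGL.exists_isTestFunctionGL_smoothedForm_ne_zero
    (P : CuspidalAutomorphicRepGL n K μ) :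
    ∃ (f : P.1.toSubmodule) (η : (AdelicGroupData.gl n K).Adelic → ℝ), IsTestFunctionGL n K η ∧ 0 ≤ η ∧
      smoothedForm η ((f : P.1.toSubmodule) : (AdelicGroupData.gl n K).L2 μ) ≠ 0 ∧
      ∃ 𝔫₀ : Ideal (𝓞 K), 𝔫₀ ≠ 0 ∧
        ∀ k : (AdelicGroupData.gl n K).Adelic, k ∈ principalCongruenceLevel n K 𝔫₀ →
          ∀ g : (AdelicGroupData.gl n K).Adelic, η (k * g) = η g := by
  haveI : Nontrivial P.1.toSubmodule :=
    ((ContRepresentation.isTopIrreducible_iff _).1 P.isTopIrreducible).1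
  obtain ⟨f, hf0⟩ := exists_ne (0 : P.1.toSubmodule)
  obtain ⟨η, hη, hη0, hne, 𝔫₀, h𝔫₀, hηK⟩ :=
    Literature.NumberTheory.Automorphic.exists_isTestFunctionGL_smoothedForm_ne_zero P.1 hf0
  exact ⟨f, η, hη, hη0, hne, 𝔫₀, h𝔫₀, hηK⟩

end TestVector

end Literature.NumberTheory.Automorphic
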